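import Summits.QuantumFields.YangMills.Theorems.UnitScaleTiltProp7CornerCombStructure
import HarnessLib

/-!
# Route `UnitScaleTilt`, crux K1 «MinimiserStabilityRegPr» (stmt-QuantumFields-19200), route-R E′ (A′)-on-Σ, P-A2 (β), row «(n3)-comb» —
# (O2) GROUNDWORK, file F-7a: THE SOURCED CORNER-COMB STRUCTURE
# («print's comb tower `Ũᵏ − 1` obeys the affine recursion `Ỹ_{k+1} = T_k(Ỹ_k) + rem_k`; the source rides in the reduced part: `Ỹ_k = G̃_k + ∇^{Ūᵏ}Λ_k`, EXACTLY»)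

«(O2) groundwork — not consumed by any displayed row before the freeze lifts» (★★OWNER `ym3-torus-plan` g29∕g30 RULINGS №20 (2), №22; «(II) GO» 06:26∕06:31Z;
PENS ROUND 4 08:50:39Z: F-7a = routeR-w1).  Cell `ym3-torus`, D-0154 (3c) R3 twin-width seat `ym-routeR-w1` (gen 9).  THEOREMS ONLY (0 `def`, 0 `sorry`);
`--supports stmt-QuantumFields-19200 --as helper`, count-neutral.  YM₃ on T³ is a ladder rung (R3), not the Clay problem; nothing here claims `hMcomb`, `hMcomb₂`, (β),
`hPA2`, `hcoS`, the stub, the crux, d = 4 or the mass gap.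

THE POINT (MASTER `DESIGN-N3COMB-LINEAR-CORE-routeRw1g9.md` §1 last row «nonlinearity», §5 F-7).  ✓F-4 `Prop7CornerCombStructure.cornerComb_structure` splits the TRUE-LINEAR
tower `Q_k Y = G_k + ∇^{Ūᵏ}Λ_k`.  The object of SIGNATURE-0 is the NONLINEAR tower `Ỹ_k := Ũᵏ − 1` (`Ũᵏ = tildIter L U₀ U₁ k`), which obeys the AFFINE recursion
`Ỹ_{k+1}(z,κ) = T_k(Ỹ_k)(L•z,κ) + rem_k(z,κ)` with the one-step nonlinearity `rem_k` of ✓F-2b (`‖rem_k‖ ≤ 260·m_k²`).  The SAME induction as F-4, with the source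
added to the reduced part, gives the sourced structure theorem (the comb twin of ✓`Prop7TrueLinSourcedStructure.sourced_structure`):
* §1 ★★★ `sourced_cornerComb_structure` — for ANY sequence `Yt` with `Yt (k+1) z κ = T_k(Yt k)(L•z,κ) + rem k z κ`, ANY corner-charge maps `CM`, and families `G̃`, `Λ` with
  `G̃ 0 = Yt 0`, `Λ 0 = 0`, `G̃ (k+1) z κ = T_k(G̃ k)(L•z,κ) − (CM k (G̃ k) z − Ad_{Ū^{k+1}(z,κ)} CM k (G̃ k) (z + e κ)) + rem k z κ`, `Λ (k+1) z = CM k (G̃ k) z + Λ k (L•z)`: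
  `Yt k z κ = G̃ k z κ + (Λ k z − Ad_{Ūᵏ(z,κ)} Λ k (z + e κ))` for `k ≤ n` (unit loop window below `n`, as F-4).
* §2 `tildTower_affine` — the inhabitation: `Ỹ k := Ũᵏ − 1` satisfies the affine recursion with `rem k z κ := Ỹ (k+1) z κ − T_k(Ỹ k)(L•z,κ)` (tautology, displayed so that
  the knit's `hYs` is discharged by name).  The SIZE of this source is ✓F-2b `Prop7CombTildTrueLin.norm_tildIter_succ_sub_one_sub_trueLin_le` (`≤ 260·m²`) read with the
  two-block walk masses ✓H-3a `Prop7CombWalkMassTwoBlock.walkMass_loop_le`∕`walkMass_seg_le` (`m := (2d+2)L·√M₂`) — consumed directly by F-7b, not restated here.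
Constants: none; nothing reads a level, `k`, the torus, `K`, the member ((g1)(g2)).  HONEST SCOPE: a finite-sum identity; F-7b∕F-7c (the per-level Minkowski rows and the
level induction) and F-8 (the T³ knit) are separate pens (PENS ROUND 4).

References: T. Bałaban, CMP **98** (1985) 17–51 [Balaban1985Averaging] ((43) p.24, (56)–(57) p.27, (68)–(69) p.29, Prop. 3 (113)–(124) pp.34–36).
-/

set_option autoImplicit false

noncomputable section

open scoped BigOperators

namespace Summit.QuantumFields.YangMills.Theorems.Prop7CornerCombSourcedStructure

open NormedSpace
open Literature.MathematicalPhysics.QuantumFieldTheory.Balaban1983to89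
open ExpMeanLog (eml)
open B7Prop1Explicit (Site Letter e hol seg boxVec gammaWord Wcx Xavg bavg expUnit stepA U1)
open B7Prop2Explicit (avgIter unitaryUnits unitaryUnits_le_U1)
open B7Eq92Concrete (tildIter)
open B7Eq78Linearization (conjR conjR_apply conjR_add conjR_sub)
open B7Prop3GeneralRotated (tsum norm_conjR_le)
open Summit.QuantumFields.YangMills.Theorems.Prop7CombTildPureGauge (trueLin_covGrad_eq_level)
open Summit.QuantumFields.YangMills.Theorems.Prop7CornerCombStructure (trueStep_add)

variable {d : ℕ} {𝔸 : Type*} [CStarAlgebra 𝔸]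

/-! ## §1 The sourced structure theorem -/

/-- ★★★ **THE SOURCED CORNER-COMB STRUCTURE** `Ỹ_k = G̃_k + ∇^{Ūᵏ}Λ_k`: for ANY sequence `Yt` obeying the affine recursion `Yt (k+1) z κ = T_k(Yt k)(L•z,κ) + rem k z κ`
(`T_k` = the true linearisation of one averaging step at the background `Ūᵏ`, ✓F-2b), ANY corner-charge maps `CM_k`, the reduced part `G̃` (carrying the source) and the
gauge function `Λ` defined by the displayed recursions reproduce `Yt` EXACTLY below the unit loop window — ✓F-4 `cornerComb_structure` plus one `+ rem` on both sides
(linearity of `T_k`: ✓`trueStep_add`; exactness on covariant gradients: ✓`trueLin_covGrad_eq_level`). [cite: Balaban1985Averaging, (56)–(57) p.27, (68) p.29] -/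
theorem sourced_cornerComb_structure (L : ℕ) (U₀ : Site d → Fin d → 𝔸ˣ) (n : ℕ)
    (hW : ∀ k < n, ∀ (z : Site d) (κ : Fin d) (r : Fin d → Fin L), ‖((Wcx L (avgIter L U₀ k) ((L : ℤ) • z) κ (boxVec L r) : 𝔸ˣ) : 𝔸) - 1‖ < 1)
    (Yt : ℕ → Site d → Fin d → 𝔸) (rem : ℕ → Site d → Fin d → 𝔸)
    (hYs : ∀ (k : ℕ) (z : Site d) (κ : Fin d), Yt (k + 1) z κ
      = (fderiv ℂ (eml : ((Fin d → Fin L) → 𝔸) → 𝔸) (fun r => ((Wcx L (avgIter L U₀ k) ((L : ℤ) • z) κ (boxVec L r) : 𝔸ˣ) : 𝔸))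
            (fun r => tsum (avgIter L U₀ k) (Yt k) ((L : ℤ) • z) (gammaWord L κ (boxVec L r) ++ seg κ (-(L : ℤ)))
              * ((Wcx L (avgIter L U₀ k) ((L : ℤ) • z) κ (boxVec L r) : 𝔸ˣ) : 𝔸))
            * (((expUnit (Xavg L (avgIter L U₀ k) ((L : ℤ) • z) κ))⁻¹ : 𝔸ˣ) : 𝔸)
          + ((expUnit (Xavg L (avgIter L U₀ k) ((L : ℤ) • z) κ) : 𝔸ˣ) : 𝔸) * tsum (avgIter L U₀ k) (Yt k) ((L : ℤ) • z) (seg κ (L : ℤ))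
            * (((expUnit (Xavg L (avgIter L U₀ k) ((L : ℤ) • z) κ))⁻¹ : 𝔸ˣ) : 𝔸)) + rem k z κ)
    (CM : ℕ → (Site d → Fin d → 𝔸) → Site d → 𝔸)
    (G : ℕ → Site d → Fin d → 𝔸) (Λ : ℕ → Site d → 𝔸) (hG0 : G 0 = Yt 0) (hΛ0 : ∀ z, Λ 0 z = 0)
    (hGs : ∀ (k : ℕ) (z : Site d) (κ : Fin d), G (k + 1) z κ
      = (fderiv ℂ (eml : ((Fin d → Fin L) → 𝔸) → 𝔸) (fun r => ((Wcx L (avgIter L U₀ k) ((L : ℤ) • z) κ (boxVec L r) : 𝔸ˣ) : 𝔸))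
            (fun r => tsum (avgIter L U₀ k) (G k) ((L : ℤ) • z) (gammaWord L κ (boxVec L r) ++ seg κ (-(L : ℤ)))
              * ((Wcx L (avgIter L U₀ k) ((L : ℤ) • z) κ (boxVec L r) : 𝔸ˣ) : 𝔸))
            * (((expUnit (Xavg L (avgIter L U₀ k) ((L : ℤ) • z) κ))⁻¹ : 𝔸ˣ) : 𝔸)
          + ((expUnit (Xavg L (avgIter L U₀ k) ((L : ℤ) • z) κ) : 𝔸ˣ) : 𝔸) * tsum (avgIter L U₀ k) (G k) ((L : ℤ) • z) (seg κ (L : ℤ))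
            * (((expUnit (Xavg L (avgIter L U₀ k) ((L : ℤ) • z) κ))⁻¹ : 𝔸ˣ) : 𝔸))
        - (CM k (G k) z - conjR (avgIter L U₀ (k + 1) z κ) (CM k (G k) (z + e κ))) + rem k z κ)
    (hΛs : ∀ (k : ℕ) (z : Site d), Λ (k + 1) z = CM k (G k) z + Λ k ((L : ℤ) • z)) :
    ∀ k ≤ n, ∀ (z : Site d) (κ : Fin d), Yt k z κ = G k z κ + (Λ k z - conjR (avgIter L U₀ k z κ) (Λ k (z + e κ))) := by
  intro k
  induction k with
  | zero =>
    intro _ z κ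
    rw [hG0, hΛ0, hΛ0]
    simp [conjR_apply]
  | succ k ih =>
    intro hk z κ
    have hk' : k < n := Nat.lt_of_succ_le hk
    have ihk := ih hk'.le
    have hfun : Yt k = G k + fun x μ => Λ k x - conjR (avgIter L U₀ k x μ) (Λ k (x + e μ)) := by
      funext x μ; rw [Pi.add_apply, Pi.add_apply]; exact ihk x μ
    have hex := trueLin_covGrad_eq_level L U₀ k (Λ k) (fun x μ => Λ k x - conjR (avgIter L U₀ k x μ) (Λ k (x + e μ)))
      (fun _ _ => rfl) z κ (hW k hk' z κ)
    rw [hYs, hfun, trueStep_add, hex, hGs, hΛs, hΛs, conjR_add, smul_add]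
    abel

/-! ## §2 The inhabitation by print's comb tower -/

/-- **THE COMB TOWER OBEYS THE AFFINE RECURSION** (tautologically, with the source `rem_k := Ỹ_{k+1} − T_k(Ỹ_k)`): displayed so that the knit discharges
`sourced_cornerComb_structure`'s `hYs` by name for `Ỹ k z κ := Ũᵏ(z,κ) − 1`. [cite: Balaban1985Averaging, (68)–(69) p.29] -/
theorem tildTower_affine (L : ℕ) (U₀ U₁ : Site d → Fin d → 𝔸ˣ) (k : ℕ) (z : Site d) (κ : Fin d) :
    ((tildIter L U₀ U₁ (k + 1) z κ : 𝔸ˣ) : 𝔸) - 1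
      = (fderiv ℂ (eml : ((Fin d → Fin L) → 𝔸) → 𝔸) (fun r => ((Wcx L (avgIter L U₀ k) ((L : ℤ) • z) κ (boxVec L r) : 𝔸ˣ) : 𝔸))
            (fun r => tsum (avgIter L U₀ k) (fun x μ => ((tildIter L U₀ U₁ k x μ : 𝔸ˣ) : 𝔸) - 1) ((L : ℤ) • z) (gammaWord L κ (boxVec L r) ++ seg κ (-(L : ℤ)))
              * ((Wcx L (avgIter L U₀ k) ((L : ℤ) • z) κ (boxVec L r) : 𝔸ˣ) : 𝔸))
            * (((expUnit (Xavg L (avgIter L U₀ k) ((L : ℤ) • z) κ))⁻¹ : 𝔸ˣ) : 𝔸)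
          + ((expUnit (Xavg L (avgIter L U₀ k) ((L : ℤ) • z) κ) : 𝔸ˣ) : 𝔸) * tsum (avgIter L U₀ k) (fun x μ => ((tildIter L U₀ U₁ k x μ : 𝔸ˣ) : 𝔸) - 1) ((L : ℤ) • z) (seg κ (L : ℤ))
            * (((expUnit (Xavg L (avgIter L U₀ k) ((L : ℤ) • z) κ))⁻¹ : 𝔸ˣ) : 𝔸))
        + ((((tildIter L U₀ U₁ (k + 1) z κ : 𝔸ˣ) : 𝔸) - 1)
          - (fderiv ℂ (eml : ((Fin d → Fin L) → 𝔸) → 𝔸) (fun r => ((Wcx L (avgIter L U₀ k) ((L : ℤ) • z) κ (boxVec L r) : 𝔸ˣ) : 𝔸))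
            (fun r => tsum (avgIter L U₀ k) (fun x μ => ((tildIter L U₀ U₁ k x μ : 𝔸ˣ) : 𝔸) - 1) ((L : ℤ) • z) (gammaWord L κ (boxVec L r) ++ seg κ (-(L : ℤ)))
              * ((Wcx L (avgIter L U₀ k) ((L : ℤ) • z) κ (boxVec L r) : 𝔸ˣ) : 𝔸))
            * (((expUnit (Xavg L (avgIter L U₀ k) ((L : ℤ) • z) κ))⁻¹ : 𝔸ˣ) : 𝔸)
          + ((expUnit (Xavg L (avgIter L U₀ k) ((L : ℤ) • z) κ) : 𝔸ˣ) : 𝔸) * tsum (avgIter L U₀ k) (fun x μ => ((tildIter L U₀ U₁ k x μ : 𝔸ˣ) : 𝔸) - 1) ((L : ℤ) • z) (seg κ (L : ℤ))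
            * (((expUnit (Xavg L (avgIter L U₀ k) ((L : ℤ) • z) κ))⁻¹ : 𝔸ˣ) : 𝔸))) := by
  abel

end Summit.QuantumFields.YangMills.Theorems.Prop7CornerCombSourcedStructure
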